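import Literature.MathematicalPhysics.QuantumFieldTheory.Balaban1983to89.B10Eq27TorusAxialLog
import Literature.MathematicalPhysics.QuantumFieldTheory.BalabanImbrieJaffe1984to88.BIJ88RT51Background
import Summits.QuantumFields.YangMills.Theorems.UnitScaleTiltProp7FlatHolonomy
import Literature.MathematicalPhysics.QuantumFieldTheory.Balaban1983to89.T3SectALandauChart
import HarnessLib

/-!
# Route `UnitScaleTilt`, crux K1 child «MinimiserStabilityRegPr» (stmt-QuantumFields-19200), registered stub `stub_prop7From14` (skeleton birth_v7
# cc37a178…; leaf V3 «Prop 7 from a background (14)») — [Balaban1985Variational] (18) / [Balaban1985RegularSpaces] p. 79: THE COMPLETE `k`-FOLD COMB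
# AXIAL GAUGE RELATIVE TO A BACKGROUND `U₀` IS REACHED INSIDE PRINT'S GROUP (4), BY EXACTLY ONE OF ITS ELEMENTS

Cell `ym3-torus` ∕ fleet seat `ym-ust-19200-p1` (gen 7; HUMAN RULING D-0037, YM ladder rung R3).  WHY.  Print reduces Proposition 7 (the leaf V3) to
the chart space (19)–(21) by FIRST fixing, inside the group (4) «u(y) = 1 for y ∈ 𝔅_k», the axial gauge `Ax_k(𝔅_k, U₀)` ([Balaban1985Variational]
p. 280: «Using the transformations (16) with u satisfying (4) we fix the axial gauge conditions Ax_k(𝔅_k, U₀)»; [Balaban1985RegularSpaces] p. 79: «The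
conditions (1.19) determine uniquely an element in each orbit given by the subgroup (1.14)»), and only THEN leaving the group (4) for the averaged
restrictions (1.29) of [Balaban1985RegularSpaces] Thm 2 ([Balaban1985RegularSpaces] p. 80: «The allowed gauge transformations u are restricted by the
conditions (1.14): u(y) = 1, y ∈ 𝔅_k. These conditions are very hard to work with analytically and we have to replace them by conditions imposed on some
averages of u»).  In the tree the knit `T3SectALandauChart.prop7From14At_of_props` (the leaf V3 from Props 2, 5, 6 at the T³ objects) carries the first
sentence as the PRESENTED law `T3SectALandauChart.AxialRepr S` on an abstract predicate `S.IsAxial`.  This file PROVES that law for the complete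
`k`-fold comb axial gauge — the gauge in which the configuration agrees with the background along every comb `Γ_{y,x}` from a `k`-fold block centre
`y` to the sites `x` of its block — for every gauge group, every torus of the `Setup` tower and every `k` in the standing range, with the explicit
(4)-element `v(x) = U₀(Γ_{y(x),x})⁻¹·U(Γ_{y(x),x})`, and proves that the (4)-element is UNIQUE (the transformation itself, not only the image).

WHAT IS PROVED (sorry-free, no definition; `holT`∕`axialT`∕`gaugeActT` = `B10Eq27TorusAxialLog`, `iterBlockOf` = `B5Eq118OneStroke`, `embIter` =
`B15DeterminingSets`; the comb word is `B7Prop1Explicit.treeWord (rel y x)`, [Balaban1984PropagatorsI] (1.7)).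
* `holT_gaugeActT`, `axialT_gaugeActT`: parallel transport ∕ comb holonomy of `V^u` = `u(start)·(…)·u(end)⁻¹` on the torus ([Balaban1985Averaging] (8)).
* **`exists_axialGauge`**: for all `U₀, U` there is `v` with `v = 1` at every `k`-fold centre `embIter k y` and
  `(U^v)(Γ_{y(x),x}) = U₀(Γ_{y(x),x})` for every site `x`, `y(x) = embIter k (iterBlockOf k x)` the centre of the `k`-block of `x`.
* **`eq_one_of_axialGauge`** (uniqueness): if `U` and `U^w` are both in that gauge and `w = 1` at the centres then `w = 1` everywhere; hence
  `axialGauge_unique` (two (4)-elements gauging `U` axially coincide) and `gaugeAct_eq_of_axialGauge`.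
* **`exists_axialGauge_T3` ∕ `existsUnique_axialGauge_T3`**: the same at the d = 3 carrier of the item (`Site (F.P K) 0`, `k = K − n`, group (4) =
  `descTransf F n K h v = 1`, read at the centres through `Prop7FlatHolonomy.transfUp_eq_embIter`) — the law `AxialRepr` of the knit for this `IsAxial`, by name:
  `axialRepr_comb`.

HONEST SCOPE.  This is the COMPLETE comb axial gauge from the `k`-fold centres (one comb `Γ_{y,x}` of the finest lattice per site).  Print's `Ax_k(𝔅_k, U₀)`
([Balaban1985RegularSpaces] (1.19)) is the ITERATED variant — level by level, the `n`-fold AVERAGED configurations are axial along the one-level combs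
`Γ_{x_{n+1},x_n}` — which is the form [Balaban1985RegularSpaces] Thm 2's induction consumes; both are complete gauges of the group (4) (one element per
orbit), and the present one is the `n = 0`-only reading.  `-- TODO(general form): (1.19) with the averaged configurations Ū'ⁿ at the levels n < k.`
Nothing of [Balaban1985Variational] ∕ [Balaban1985RegularSpaces] beyond these two sentences is claimed; no sup-norm bound ((1.25)) is proved here.

References: T. Bałaban, CMP 102 (1985) 277–309 [Balaban1985Variational] ((4) p.278, (16)–(18) p.280); CMP 99 (1985) 75–102 [Balaban1985RegularSpaces]
((1.14) p.78, (1.19) and the sentence after (1.20) p.79, p.80); CMP 98 (1985) 17–51 [Balaban1985Averaging] ((8)–(9) pp.18–19, p.24); CMP 95 (1984) 17–40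
[Balaban1984PropagatorsI] ((1.7) p.18).
-/

noncomputable section

namespace Summit.QuantumFields.YangMills.Theorems.Prop7AxialGauge

open Literature.MathematicalPhysics.QuantumFieldTheory.Balaban1983to89
open B10Eq27TorusAxialLog (holT axialT gaugeActT transl pull rel holT_nil gaugeActT_apply hol_pull_zero pull_gaugeActT transl_zero
  transl_disp_treeWord_rel axialT_self gaugeActT_eq_gaugeAct)
open B7Prop1Explicit (treeWord disp hol_gaugeAct)
open B5Eq118OneStroke (iterBlockOf)
open B15DeterminingSets (embIter)
open Literature.MathematicalPhysics.QuantumFieldTheory.BalabanImbrieJaffe1984to88.BIJ88RT51Background (iterBlockOf_embIter)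

/-! ## §1 Gauge covariance of torus transport and of the comb holonomy -/

section Covariance

variable {P : Params} {j : ℕ} {G : Type*} [Group G]

/-- [Balaban1985Averaging] (8) along an arbitrary lattice word on the torus: `V^u(Γ) = u(Γ₋)·V(Γ)·u(Γ₊)⁻¹`, the end point read as `x + disp Γ`.
[cite: Balaban1985Averaging, (8) p.18] -/
theorem holT_gaugeActT (u : GaugeTransf P j G) (V : GaugeField P j G) (x : Site P j) (w : List (B7Prop1Explicit.Letter P.d)) :
    holT (gaugeActT u V) x w = u x * holT V x w * (u (transl x (disp w)))⁻¹ := by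
  rw [← hol_pull_zero, pull_gaugeActT, hol_gaugeAct, hol_pull_zero, zero_add, transl_zero]

/-- The comb holonomy `U(Γ_{y,x})` of [Balaban1985Averaging] p. 24 transforms as `U^u(Γ_{y,x}) = u(y)·U(Γ_{y,x})·u(x)⁻¹`.
[cite: Balaban1985Averaging, (8) p.18, p.24] -/
theorem axialT_gaugeActT (u : GaugeTransf P j G) (V : GaugeField P j G) (y x : Site P j) :
    axialT (gaugeActT u V) y x = u y * axialT V y x * (u x)⁻¹ := by
  unfold axialT
  rw [holT_gaugeActT, transl_disp_treeWord_rel]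

end Covariance

/-! ## §2 The complete `k`-fold comb axial gauge inside the group (4): existence with the explicit element, and uniqueness -/

section Axial

variable {P : Params} {G : Type*} [Group G]

/-- **EXISTENCE — [Balaban1985Variational] p. 280 «Using the transformations (16) with u satisfying (4) we fix the axial gauge conditions
Ax_k(𝔅_k, U₀)», complete-comb reading**: for every background `U₀` and every configuration `U` of the finest torus there is a gauge transformation
`v` with `v = 1` at every `k`-fold block centre (print's group (4), [Balaban1985Variational] (4)) such that `U^v` has the same holonomy as `U₀` along
every comb `Γ_{y(x),x}` from the centre `y(x)` of the `k`-block of `x` to `x`.  The element is explicit: `v(x) = U₀(Γ_{y(x),x})⁻¹·U(Γ_{y(x),x})`.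
[cite: Balaban1985Variational, (18) p.280; Balaban1985RegularSpaces, (1.19) p.79] -/
theorem exists_axialGauge {k : ℕ} (hk : k ≤ P.m + P.K) (U₀ U : GaugeField P 0 G) :
    ∃ v : GaugeTransf P 0 G, (∀ y : Site P k, v (embIter k y) = 1) ∧
      ∀ x : Site P 0, axialT (gaugeActT v U) (embIter k (iterBlockOf k x)) x = axialT U₀ (embIter k (iterBlockOf k x)) x := by
  refine ⟨fun x => (axialT U₀ (embIter k (iterBlockOf k x)) x)⁻¹ * axialT U (embIter k (iterBlockOf k x)) x, fun y => ?_, fun x => ?_⟩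
  · simp only [iterBlockOf_embIter k hk y, axialT_self, inv_one, mul_one]
  · rw [axialT_gaugeActT]
    simp only [iterBlockOf_embIter k hk, axialT_self, inv_one, one_mul, mul_inv_rev, inv_inv, mul_inv_cancel_left]

/-- **UNIQUENESS OF THE (4)-ELEMENT — [Balaban1985RegularSpaces] p. 79 «The conditions (1.19) determine uniquely an element in each orbit given by
the subgroup (1.14)», complete-comb reading, strong form**: if `U` is in the comb axial gauge relative to `U₀` and so is `U^w` for a `w` of the group
(4), then `w = 1` identically (not only `U^w = U`). [cite: Balaban1985RegularSpaces, p.79 (sentence after (1.20)); Balaban1985Variational, (4) p.278] -/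
theorem eq_one_of_axialGauge {k : ℕ} (U₀ U : GaugeField P 0 G) (w : GaugeTransf P 0 G) (hw : ∀ y : Site P k, w (embIter k y) = 1)
    (hU : ∀ x : Site P 0, axialT U (embIter k (iterBlockOf k x)) x = axialT U₀ (embIter k (iterBlockOf k x)) x)
    (hwU : ∀ x : Site P 0, axialT (gaugeActT w U) (embIter k (iterBlockOf k x)) x = axialT U₀ (embIter k (iterBlockOf k x)) x) :
    w = fun _ => 1 := by
  funext x
  have h := hwU x
  rw [axialT_gaugeActT, hw, one_mul, hU x] at h
  -- `h : U₀(Γ) · (w x)⁻¹ = U₀(Γ)`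
  have h' := congrArg (fun g => (axialT U₀ (embIter k (iterBlockOf k x)) x)⁻¹ * g) h
  simp only [inv_mul_cancel_left, inv_mul_cancel] at h'
  exact inv_eq_one.mp h'

/-- Uniqueness of the gauging element: two elements of the group (4) taking `U` to the comb axial gauge relative to `U₀` coincide.
[cite: Balaban1985RegularSpaces, p.79 (sentence after (1.20))] -/
theorem axialGauge_unique {k : ℕ} (U₀ U : GaugeField P 0 G) (v v' : GaugeTransf P 0 G)
    (hv : ∀ y : Site P k, v (embIter k y) = 1) (hv' : ∀ y : Site P k, v' (embIter k y) = 1)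
    (hvU : ∀ x : Site P 0, axialT (gaugeActT v U) (embIter k (iterBlockOf k x)) x = axialT U₀ (embIter k (iterBlockOf k x)) x)
    (hv'U : ∀ x : Site P 0, axialT (gaugeActT v' U) (embIter k (iterBlockOf k x)) x = axialT U₀ (embIter k (iterBlockOf k x)) x) :
    v' = v := by
  -- `U^{v'} = (U^v)^{v'v⁻¹}` and `v'v⁻¹` lies in (4)
  have hcomp : gaugeActT v' U = gaugeActT (fun x => v' x * (v x)⁻¹) (gaugeActT v U) := by
    funext b
    simp only [gaugeActT_apply, mul_inv_rev, inv_inv, mul_assoc, inv_mul_cancel_left]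
  have h1 := eq_one_of_axialGauge (k := k) U₀ (gaugeActT v U) (fun x => v' x * (v x)⁻¹)
    (fun y => by simp only [hv y, hv' y, inv_one, mul_one]) hvU (by rw [← hcomp]; exact hv'U)
  funext x
  have hx := congrFun h1 x
  exact mul_inv_eq_one.mp hx

/-- Hence the axial IMAGE is unique as well: one configuration per (4)-orbit in the comb axial gauge. [cite: Balaban1985RegularSpaces, p.79 (sentence after (1.20))] -/
theorem gaugeAct_eq_of_axialGauge {k : ℕ} (U₀ U : GaugeField P 0 G) (v v' : GaugeTransf P 0 G)
    (hv : ∀ y : Site P k, v (embIter k y) = 1) (hv' : ∀ y : Site P k, v' (embIter k y) = 1)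
    (hvU : ∀ x : Site P 0, axialT (gaugeActT v U) (embIter k (iterBlockOf k x)) x = axialT U₀ (embIter k (iterBlockOf k x)) x)
    (hv'U : ∀ x : Site P 0, axialT (gaugeActT v' U) (embIter k (iterBlockOf k x)) x = axialT U₀ (embIter k (iterBlockOf k x)) x) :
    gaugeActT v' U = gaugeActT v U := by
  rw [axialGauge_unique U₀ U v v' hv hv' hvU hv'U]

/-- The background itself is in its own comb axial gauge, gauged by `v = 1`. [cite: Balaban1985RegularSpaces, (1.19) p.79] -/
theorem axialGauge_self {k : ℕ} (U₀ : GaugeField P 0 G) (x : Site P 0) :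
    axialT (gaugeActT (fun _ => (1 : G)) U₀) (embIter k (iterBlockOf k x)) x = axialT U₀ (embIter k (iterBlockOf k x)) x := by
  rw [axialT_gaugeActT, one_mul, inv_one, mul_one]

end Axial

/-! ## §3 At the d = 3 carrier of the item: the law `AxialRepr` of the knit `T3SectALandauChart` for the comb axial gauge -/

section T3

open Literature.MathematicalPhysics.QuantumFieldTheory.Balaban1983to89.T3ContinuumYM3Torus
open Literature.MathematicalPhysics.QuantumFieldTheory.Balaban1983to89.T3LevelShift
open Literature.MathematicalPhysics.QuantumFieldTheory.Balaban1983to89.T3PrintedRegularOrbits (descTransf sites_eq)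
open Summit.QuantumFields.YangMills.Theorems.Prop7FlatHolonomy (transfUp_eq_embIter)

variable (F : T3Family) {n K : ℕ} (h : n ≤ K)

/-- **THE LAW `AxialRepr` AT THE T³ CARRIER, PROVED** (configurations of run `K`'s finest lattice, data height `n`, `k = K − n`, group (4) = `u↓ = 1` =
`descTransf F n K h v = 1`): every `SU(2)` configuration `U` has a (4)-gauge image in the complete comb axial gauge relative to any background `U₀`.
[cite: Balaban1985Variational, (18) p.280; Balaban1985RegularSpaces, p.79 (sentence after (1.20))] -/
theorem exists_axialGauge_T3 (U₀ U : GaugeField (F.P K) 0 (Matrix.specialUnitaryGroup (Fin 2) ℂ)) :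
    ∃ v : GaugeTransf (F.P K) 0 (Matrix.specialUnitaryGroup (Fin 2) ℂ), descTransf F n K h v = (fun _ => 1) ∧
      ∀ x : Site (F.P K) 0, axialT (GaugeField.gaugeAct v U) (embIter (K - n) (iterBlockOf (K - n) x)) x =
        axialT U₀ (embIter (K - n) (iterBlockOf (K - n) x)) x := by
  obtain ⟨v, hv, hax⟩ := exists_axialGauge (P := F.P K) (k := K - n) (by show K - n ≤ F.m + K; omega) U₀ U
  refine ⟨v, ?_, fun x => by rw [← gaugeActT_eq_gaugeAct]; exact hax x⟩
  -- `u↓ = 1` IS `u = 1` at the `(K−n)`-fold centres (`descTransf` = `transfUp` read through `siteShift`, `transfUp u k = u ∘ embIter k`)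
  funext x
  unfold descTransf
  rw [transfUp_eq_embIter]
  exact hv _

/-- … and the (4)-element is unique. [cite: Balaban1985RegularSpaces, p.79 (sentence after (1.20))] -/
theorem existsUnique_axialGauge_T3 (U₀ U : GaugeField (F.P K) 0 (Matrix.specialUnitaryGroup (Fin 2) ℂ)) :
    ∃! v : GaugeTransf (F.P K) 0 (Matrix.specialUnitaryGroup (Fin 2) ℂ), descTransf F n K h v = (fun _ => 1) ∧
      ∀ x : Site (F.P K) 0, axialT (GaugeField.gaugeAct v U) (embIter (K - n) (iterBlockOf (K - n) x)) x =
        axialT U₀ (embIter (K - n) (iterBlockOf (K - n) x)) x := by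
  obtain ⟨v, hv, hax⟩ := exists_axialGauge (P := F.P K) (k := K - n) (by show K - n ≤ F.m + K; omega) U₀ U
  -- reading `u↓ = 1` at the centres: `descTransf u = 1 ↔ u ∘ embIter (K−n) = 1`
  have hcentre : ∀ u : GaugeTransf (F.P K) 0 (Matrix.specialUnitaryGroup (Fin 2) ℂ),
      descTransf F n K h u = (fun _ => 1) → ∀ y : Site (F.P K) (K - n), u (embIter (K - n) y) = 1 := by
    intro u hu y
    have h1 := congrFun hu ((siteShift (sites_eq F n K h)).symm y)
    unfold descTransf at h1
    rwa [transfUp_eq_embIter, Equiv.apply_symm_apply] at h1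
  refine ⟨v, ⟨?_, fun x => by rw [← gaugeActT_eq_gaugeAct]; exact hax x⟩, fun v' hv' => ?_⟩
  · funext x
    unfold descTransf
    rw [transfUp_eq_embIter]
    exact hv _
  · exact axialGauge_unique (k := K - n) U₀ U v v' hv (hcentre v' hv'.1) hax
      (fun x => by rw [gaugeActT_eq_gaugeAct]; exact hv'.2 x)

/-- **`T3SectALandauChart.AxialRepr` DISCHARGED for every presentation whose `IsAxial` is the complete comb axial gauge**: the knit
`prop7From14At_of_props_of_located` takes this law as an input; here it is a theorem. [cite: Balaban1985Variational, p.280 (sentence before (18))] -/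
theorem axialRepr_comb (S : T3SectALandauChart.Resid F n K)
    (hS : ∀ U₀ U : GaugeField (F.P K) 0 (Matrix.specialUnitaryGroup (Fin 2) ℂ), S.IsAxial U₀ U ↔
      ∀ x : Site (F.P K) 0, axialT U (embIter (K - n) (iterBlockOf (K - n) x)) x = axialT U₀ (embIter (K - n) (iterBlockOf (K - n) x)) x) :
    T3SectALandauChart.AxialRepr F n K h S := by
  intro U₀ U
  obtain ⟨v, hv, hax⟩ := exists_axialGauge_T3 F h U₀ U
  exact ⟨v, hv, (hS U₀ _).mpr hax⟩

end T3

end Summit.QuantumFields.YangMills.Theorems.Prop7AxialGauge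

end
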